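import Summits.CriticalPhenomena.CardyFormulaZ2.Theorems.UniformBoxCrossing.Negative.FalseWithoutFKG
import HarnessLib

/-!
# The soft structure persists on the whole extended corner family
(negative-side support for crux `UniformBoxCrossing`, stmt-CriticalPhenomena-5476; cdisprove findings
`Cruxes/UniformBoxCrossing/Disproof.lean` §2c, landed verbatim by the line lead; part 4 of 5)

Port of `CornerPercolation`'s symmetry section to `extCornerPercolation s`, every `s ∈ [0,1]`:
translation invariance, transpose (diagonal) invariance, self-duality `map dualConfig = map (point
reflection)`, `M_s(LR(m+1,n)) + M_s(LR(n+1,m)) = 1` and `M_s(LR(n+1,n)) = 1/2` EXACTLY. Capstone no-go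
`exists_selfDual_symmetric_exactHalf_not_boxCrossing`: a translation- and diagonally-invariant, self-dual
probability measure on bond configurations of `ℤ²` (a range-1 block factor of i.i.d. coins) with ALL
`(n+1) × n` rectangles crossed with probability exactly `1/2` that does NOT have the box-crossing
property.
-/

namespace Summit.CriticalPhenomena.CardyFormulaZ2.Theorems.UniformBoxCrossing.Negative

open MeasureTheory Filter Literature.Probability.Percolation Literature.Probability.LatticeModels
open Summit.CriticalPhenomena.CardyFormulaZ2.Theses.CardySelfDualSegment
open scoped Topology

noncomputable section

/-! ### The soft structure persists on the whole extended family: invariances, self-duality and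
exact-`1/2` squares for `extCornerPercolation s`, every `s ∈ [0, 1]` -/

/-- Probabilities of measurable events under `M_s` are `prodBernoulli`-probabilities of their
preimages under the corner map. -/
theorem extCornerPercolation_apply (s : unitInterval) {A : Set (BondConfig (Site 2))}
    (hA : MeasurableSet A) :
    extCornerPercolation s A = prodBernoulli (extCornerParam s) (cornerConfig ⁻¹' A) :=
  Measure.map_apply measurable_cornerConfig hA

/-- `M_s` is carried by configurations of lattice edges. -/
theorem extCornerPercolation_subset_edgeSet (s : unitInterval) :
    ∀ᵐ ω ∂(extCornerPercolation s), ω ⊆ (zdGraph 2).edgeSet := by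
  have hmeas : MeasurableSet {ω : BondConfig (Site 2) | ω ⊆ (zdGraph 2).edgeSet} := by
    have h : {ω : BondConfig (Site 2) | ω ⊆ (zdGraph 2).edgeSet} =
        ⋂ e ∈ ((zdGraph 2).edgeSet)ᶜ, {ω | e ∉ ω} := by
      ext ω
      simp only [Set.mem_setOf_eq, Set.mem_iInter, Set.mem_compl_iff]
      exact ⟨fun h e he heω => he (h heω), fun h e heω => by_contra fun he => h e he heω⟩
    rw [h]
    exact MeasurableSet.biInter (Set.to_countable _) fun e _ => (measurableSet_mem e).compl
  rw [ae_iff, ← Set.compl_setOf, extCornerPercolation_apply s hmeas.compl]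
  have h : cornerConfig ⁻¹' {ω : BondConfig (Site 2) | ω ⊆ (zdGraph 2).edgeSet}ᶜ = ∅ := by
    ext S
    simp only [Set.preimage_compl, Set.mem_compl_iff, Set.mem_preimage, Set.mem_setOf_eq,
      Set.mem_empty_iff_false, iff_false, not_not]
    exact cornerConfig_subset_edgeSet S
  rw [h, measure_empty]

/-- Vertex relabellings preserve `prodBernoulli (extCornerParam s)` (the parameters do not depend
on the vertex). -/
theorem prodBernoulli_extCornerParam_map_vertexReindex (s : unitInterval) (π : Site 2 ≃ Site 2) :
    (prodBernoulli (extCornerParam s)).map (vertexReindex π) =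
      prodBernoulli (extCornerParam s) := by
  have h : vertexReindex π = fun S => (Equiv.prodCongr π (Equiv.refl (Fin 2))).symm '' S :=
    funext (vertexReindex_eq_image π)
  rw [h]
  exact prodBernoulli_map_image_equiv _ _ fun _ => rfl

/-- Block maps by an involution of `{0,1}²` fixing the splitting bit preserve
`prodBernoulli (extCornerParam s)`: they permute, for each value of the splitting bit, the two
values of the FAIR coin — the only feature of the corner law they use. -/
theorem prodBernoulli_extCornerParam_map_blockMap (s : unitInterval)
    {Φ : (Fin 2 → Prop) → (Fin 2 → Prop)} (hΦ : Function.Involutive Φ) (h1 : ∀ g, Φ g 1 = g 1) :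
    (prodBernoulli (extCornerParam s)).map (blockMap Φ) = prodBernoulli (extCornerParam s) := by
  refine prodBernoulli_map_blockMap _ _ Φ fun v => ?_
  refine map_eq_self_of_involutive _ hΦ fun g => ?_
  rw [Measure.pi_singleton, Measure.pi_singleton, Fin.prod_univ_two, Fin.prod_univ_two, h1 g,
    extCornerParam_apply_zero, bernoulli_half_singleton, bernoulli_half_singleton]

/-- Invariance principle for `M_s` (as `cornerPercolation_map_eq_of_comm`). -/
theorem extCornerPercolation_map_eq_of_comm (s : unitInterval)
    {F : BondConfig (Site 2) → BondConfig (Site 2)} (hF : Measurable F)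
    {G : Set (Site 2 × Fin 2) → Set (Site 2 × Fin 2)} (hG : Measurable G)
    (hlaw : (prodBernoulli (extCornerParam s)).map G = prodBernoulli (extCornerParam s))
    (hcomm : ∀ S, F (cornerConfig S) = cornerConfig (G S)) :
    (extCornerPercolation s).map F = extCornerPercolation s := by
  rw [extCornerPercolation, Measure.map_map hF measurable_cornerConfig,
    show F ∘ cornerConfig = cornerConfig ∘ G from funext hcomm,
    ← Measure.map_map measurable_cornerConfig hG, hlaw]

/-- Transfer principle for `M_s` (as `cornerPercolation_map_eq_map_of_comm`). -/
theorem extCornerPercolation_map_eq_map_of_comm (s : unitInterval)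
    {F F' : BondConfig (Site 2) → BondConfig (Site 2)} (hF : Measurable F) (hF' : Measurable F')
    {G : Set (Site 2 × Fin 2) → Set (Site 2 × Fin 2)} (hG : Measurable G)
    (hlaw : (prodBernoulli (extCornerParam s)).map G = prodBernoulli (extCornerParam s))
    (hcomm : ∀ S, F (cornerConfig S) = F' (cornerConfig (G S))) :
    (extCornerPercolation s).map F = (extCornerPercolation s).map F' := by
  rw [extCornerPercolation, Measure.map_map hF measurable_cornerConfig,
    show F ∘ cornerConfig = (F' ∘ cornerConfig) ∘ G from funext hcomm,
    ← Measure.map_map (hF'.comp measurable_cornerConfig) hG, hlaw,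
    Measure.map_map hF' measurable_cornerConfig]

/-- **Translation invariance of `M_s`.** -/
theorem extCornerPercolation_map_relabel_shift (s : unitInterval) (a : Site 2) :
    (extCornerPercolation s).map (BondConfig.relabel (sym2Equiv (Site.shift a))) =
      extCornerPercolation s :=
  extCornerPercolation_map_eq_of_comm s (MeasurableEquiv.measurable _) (measurable_vertexReindex _)
    (prodBernoulli_extCornerParam_map_vertexReindex s _) (relabel_shift_cornerConfig a)

/-- Applied form: `M_s {ω | ω + a ∈ A} = M_s(A)`. -/
theorem extCornerPercolation_real_preimage_relabel_shift (s : unitInterval) (a : Site 2)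
    (A : Set (BondConfig (Site 2))) :
    (extCornerPercolation s).real (BondConfig.relabel (sym2Equiv (Site.shift a)) ⁻¹' A) =
      (extCornerPercolation s).real A := by
  rw [measureReal_def, measureReal_def, ← MeasurableEquiv.map_apply,
    extCornerPercolation_map_relabel_shift]

/-- **`M_s` is invariant under the transposition of the axes** (the diagonal reflection). -/
theorem extCornerPercolation_map_relabel_transpose (s : unitInterval) :
    (extCornerPercolation s).map (BondConfig.relabel (sym2Equiv transposeIso.toEquiv)) =
      extCornerPercolation s := by
  rw [transposeIso_toEquiv]
  refine extCornerPercolation_map_eq_of_comm s (MeasurableEquiv.measurable _)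
    ((measurable_blockMap _).comp (measurable_vertexReindex _)) ?_ relabel_transpose_cornerConfig
  rw [← Measure.map_map (measurable_blockMap _) (measurable_vertexReindex _),
    prodBernoulli_extCornerParam_map_vertexReindex,
    prodBernoulli_extCornerParam_map_blockMap s transposeBit_involutive transposeBit_one]

/-- Applied form: `M_s {ω | ωᵀ ∈ A} = M_s(A)`. -/
theorem extCornerPercolation_real_preimage_relabel_transpose (s : unitInterval)
    (A : Set (BondConfig (Site 2))) :
    (extCornerPercolation s).real (BondConfig.relabel (sym2Equiv transposeIso.toEquiv) ⁻¹' A) =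
      (extCornerPercolation s).real A := by
  rw [measureReal_def, measureReal_def, ← MeasurableEquiv.map_apply,
    extCornerPercolation_map_relabel_transpose]

/-- **Self-duality of `M_s`** for every `s`: the law of the dual configuration is the law of the
point-reflected configuration. -/
theorem extCornerPercolation_map_dualConfig (s : unitInterval) :
    (extCornerPercolation s).map dualConfig =
      (extCornerPercolation s).map (BondConfig.relabel (sym2Equiv (Equiv.neg (Site 2)))) := by
  refine extCornerPercolation_map_eq_map_of_comm s measurable_dualConfig
    (MeasurableEquiv.measurable _) ((measurable_blockMap _).comp (measurable_vertexReindex _)) ?_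
    dualConfig_cornerConfig
  rw [← Measure.map_map (measurable_blockMap _) (measurable_vertexReindex _),
    prodBernoulli_extCornerParam_map_vertexReindex,
    prodBernoulli_extCornerParam_map_blockMap s dualBit_involutive dualBit_one]

/-- Applied form of self-duality: `M_s {ω | dualConfig ω ∈ A} = M_s {ω | -ω ∈ A}`. -/
theorem extCornerPercolation_real_preimage_dualConfig (s : unitInterval)
    {A : Set (BondConfig (Site 2))} (hA : MeasurableSet A) :
    (extCornerPercolation s).real (dualConfig ⁻¹' A) =
      (extCornerPercolation s).real
        (BondConfig.relabel (sym2Equiv (Equiv.neg (Site 2))) ⁻¹' A) := by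
  rw [measureReal_def, measureReal_def, ← Measure.map_apply measurable_dualConfig hA,
    extCornerPercolation_map_dualConfig, MeasurableEquiv.map_apply]

/-- `M_s(LR(m, n)) + M_s(TB*(m, n)) = 1`. -/
theorem extCornerPercolation_real_lrCrossing_add_dualTBCrossing (s : unitInterval) (m n : ℕ) :
    (extCornerPercolation s).real (lrCrossing m n) +
      (extCornerPercolation s).real (dualTBCrossing m n) = 1 := by
  set μ := extCornerPercolation s
  have hae : ∀ᵐ ω ∂μ, ω ⊆ (zdGraph 2).edgeSet := extCornerPercolation_subset_edgeSet s
  have hunion : μ.real (lrCrossing m n ∪ dualTBCrossing m n) = 1 := by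
    rw [← probReal_univ (μ := μ)]
    refine measureReal_congr (ae_eq_univ.2 ?_)
    rw [measure_eq_zero_iff_ae_notMem]
    filter_upwards [hae] with ω hω hn
    rcases lrCrossing_xor_dualTBCrossing_holds m n hω with h | h
    · exact hn (Or.inl h.1)
    · exact hn (Or.inr h.1)
  have hinter : μ.real (lrCrossing m n ∩ dualTBCrossing m n) = 0 := by
    rw [measureReal_def, measure_eq_zero_iff_ae_notMem.2, ENNReal.toReal_zero]
    filter_upwards [hae] with ω hω hn
    rcases lrCrossing_xor_dualTBCrossing_holds m n hω with h | h
    · exact h.2 hn.2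
    · exact h.2 hn.1
  have h := measureReal_union_add_inter (μ := μ) (s := lrCrossing m n)
    (measurableSet_dualTBCrossing m n)
  rw [hunion, hinter, add_zero] at h
  exact h.symm

/-- Translated open crossing events have the same `M_s`-probability. -/
theorem extCornerPercolation_real_openCrossing_shift (s : unitInterval) (v : Site 2)
    (S A B : Set (Site 2)) :
    (extCornerPercolation s).real (openCrossing ((· + v) '' S) ((· + v) '' A) ((· + v) '' B)) =
      (extCornerPercolation s).real (openCrossing S A B) := by
  rw [← preimage_relabel_openCrossing (Site.shift v) S A B,
    extCornerPercolation_real_preimage_relabel_shift]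
  rfl

/-- `M_s(TB([0, n] × [0, m])) = M_s(LR([0, m] × [0, n]))`. -/
theorem extCornerPercolation_real_tbCrossing (s : unitInterval) (m n : ℕ) :
    (extCornerPercolation s).real (tbCrossing n m) =
      (extCornerPercolation s).real (lrCrossing m n) := by
  rw [← preimage_relabel_transpose_tbCrossing m n,
    extCornerPercolation_real_preimage_relabel_transpose]

/-- `M_s(TB*(m + 1, n)) = M_s(LR([0, n + 1] × [0, m]))`. -/
theorem extCornerPercolation_real_dualTBCrossing_succ (s : unitInterval) (m n : ℕ) :
    (extCornerPercolation s).real (dualTBCrossing (m + 1) n) =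
      (extCornerPercolation s).real (lrCrossing (n + 1) m) := by
  have hX : MeasurableSet (openCrossing (↑(dualRectangle (m + 1) n) : Set (Site 2))
      ↑(dualTopSide (m + 1) n) ↑(dualBottomSide (m + 1) n)) := measurableSet_openCrossing _ _ _
  rw [dualTBCrossing, extCornerPercolation_real_preimage_dualConfig s hX,
    ← negEquiv_image_rectangle, ← negEquiv_image_bottomSide, ← negEquiv_image_topSide,
    preimage_relabel_openCrossing (Equiv.neg (Site 2)),
    extCornerPercolation_real_openCrossing_shift,
    ← extCornerPercolation_real_tbCrossing s (n + 1) m]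
  rfl

/-- **Complementary rectangles** for every `s`:
`M_s(LR([0, m + 1] × [0, n])) + M_s(LR([0, n + 1] × [0, m])) = 1`. -/
theorem extCornerPercolation_real_lrCrossing_add (s : unitInterval) (m n : ℕ) :
    (extCornerPercolation s).real (lrCrossing (m + 1) n) +
      (extCornerPercolation s).real (lrCrossing (n + 1) m) = 1 := by
  rw [← extCornerPercolation_real_dualTBCrossing_succ s m n]
  exact extCornerPercolation_real_lrCrossing_add_dualTBCrossing s (m + 1) n

/-- **`M_s` crosses the `(n + 1) × n` rectangle with probability EXACTLY `1/2`, for every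
`s ∈ [0, 1]`** — in particular at the laminated endpoint `s = 1`, where box crossing fails
(`not_hasBoxCrossingProperty_laminated`): exact-`1/2` squares, self-duality, translation and
diagonal-reflection invariance do not imply the box-crossing property. -/
theorem extCornerPercolation_real_lrCrossing_succ_self (s : unitInterval) (n : ℕ) :
    (extCornerPercolation s).real (lrCrossing (n + 1) n) = 1 / 2 := by
  have h := extCornerPercolation_real_lrCrossing_add s n n
  linarith

/-- **Capstone (no-go form).** There is a probability measure on bond configurations of `ℤ²` —
the laminated corner model `extCornerPercolation 1`, a range-1 block factor of i.i.d. fair coins —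
that is translation invariant, invariant under the diagonal reflection, self-dual (law of the
dual configuration = law of the point-reflected configuration), crosses EVERY `(n + 1) × n`
lattice rectangle with probability exactly `1/2`, and yet does NOT have the box-crossing property
on `√2 ℤ²`. Hence no argument from these properties alone proves `UniformBoxCrossing`. -/
theorem exists_selfDual_symmetric_exactHalf_not_boxCrossing :
    ∃ μ : Measure (BondConfig (Site 2)), IsProbabilityMeasure μ ∧
      (∀ a : Site 2, μ.map (BondConfig.relabel (sym2Equiv (Site.shift a))) = μ) ∧
      μ.map (BondConfig.relabel (sym2Equiv transposeIso.toEquiv)) = μ ∧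
      μ.map dualConfig = μ.map (BondConfig.relabel (sym2Equiv (Equiv.neg (Site 2)))) ∧
      (∀ n : ℕ, μ.real (lrCrossing (n + 1) n) = 1 / 2) ∧
      ¬ HasBoxCrossingProperty μ squareLatticeEmbedding.z :=
  ⟨extCornerPercolation 1, inferInstance, extCornerPercolation_map_relabel_shift 1,
    extCornerPercolation_map_relabel_transpose 1, extCornerPercolation_map_dualConfig 1,
    extCornerPercolation_real_lrCrossing_succ_self 1, not_hasBoxCrossingProperty_laminated⟩


end

end Summit.CriticalPhenomena.CardyFormulaZ2.Theorems.UniformBoxCrossing.Negative
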